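import Summits.SmoothPoincare4.SmoothPoincare4.Theorems.ConvexBisectionAcyclicBisectionExistsPageTubeDeriv
import Summits.SmoothPoincare4.SmoothPoincare4.Theorems.ConvexBisectionAcyclicBisectionExistsPageTubeLocal
import Literature.Topology.FourManifolds.BlowDownFlatModel
import HarnessLib

/-!
# The page-adapted circle tube around an embedded page curve in `∂ Base g`
(wave 3, worker Z4, brick T3c-1 (3b) "page-adapted circle tube", part 5 (assembly), of stub
`stub_steinRealisation` = NF6 `Literature.Geometry.Symplectic.steinRealisation_of_sorted_modelsOnFibred`,
line `modp-braid-orbits` r11, crux `ConvexBisection.AcyclicBisectionExists`, item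
stmt-SmoothPoincare4-10508; registered sub-goal `helper_exists_pageTube`)

Node T3c-1 ("belt circles are isotopic to page push-offs in `∂X`") compares two tubes around the
attaching circle `K` of a Lefschetz 2-handle in the boundary 3-manifold `Y = ∂ Base g` of the base:
the boundary tube of the attaching map (`HandleAttachingMap.boundaryTube`) and a tube ADAPTED TO THE
PAGES, by the uniqueness of tubes around a circle (`CircleTube.exists_diffeotopy_reflect`,
`CircleTubeUniqueness.lean`; Kosinski 1993, III (3.5)).  This file delivers the page-adapted tube
(`helper_exists_pageTube`): for a smooth embedding `K : 𝕊¹ → Base g` into the page `page g c` there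
are a rate `κ > 0`, the page-rotation isotopy `R` of the base at rate `κ` (flow `θ` of
`κ · rotField g`, `…PageRotationFlow.lean`) and a `CircleTube Y` `Φ` with core `K`, FIBRED over the
pages — `Φ (ψ, v) = R_{v₁} (Φ (ψ, v₀ e₀))` and `Φ (ψ, v)` lies in the page `page g (e^{iκv₁} c)`, so
the first fibre coordinate moves inside the page of `K` and the second is the page angle — and with
fibre derivative `(r · i K', κ · rotField)` at the zero section (`r > 0`).

* §1 rescaling an open partial homeomorphism with source `𝕊¹ × B(0, ε)` to the unit tube
  (`scaleTube`), as a `CircleTube`; §1b `twistTube Φ σ` — any `CircleTube` precomposed with the fibre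
  twist `circleTwist σ` (`σ = ±1`; same core and target), for the degree bookkeeping of stage (3c);
* §2 assembly: the in-page flow `Θ` (`helper_pageField_flow`) and the rotation flow `θ` give the tube
  map `tubeMap` (`…PageTubeMap.lean`), a local diffeomorphism along the zero section
  (`…PageTubeDeriv.lean`, `…PageTubeLocal.lean`), hence a tube diffeomorphism on `𝕊¹ × B(0, ε)`
  (`helper_tube_of_localDiffeo_zero`), inside the flat part `‖x‖² < 4`; rescaled to the unit tube
  with the rotation clock rescaled to rate `κ = ε`.

Everything is proved; no named facts, no `sorry`.  References: A. A. Kosinski, *Differential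
Manifolds* (1993), III (3.1), (3.5) [Kosinski1993]; R. E. Gompf, A. I. Stipsicz, *4-Manifolds and
Kirby Calculus* (1999), §8.2 (vanishing cycles in pages of `F × S¹ ⊂ ∂(F × D²)`) [GompfStipsicz1999].
-/

noncomputable section

set_option linter.dupNamespace false

open scoped Manifold ContDiff Topology ComplexConjugate
open Set Function Metric Filter
open Literature.Topology.FourManifolds Literature.Topology.FourManifolds.LefschetzBase
open Literature.Geometry.Symplectic

namespace Summit.SmoothPoincare4.SmoothPoincare4.Theorems.AcyclicBisectionExists.ModpBraidOrbits

variable {g : ℕ}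

/-- The boundary 3-manifold of the base is Hausdorff. [folklore] -/
instance t2Space_bBase_carrier (g : ℕ) : T2Space (bBase g).carrier :=
  inferInstanceAs (T2Space ↥((𝓡∂ 4).boundary (Base g)))

/-- The circle is non-empty. [folklore] -/
instance nonempty_circle : Nonempty (sphere (0 : EuclideanSpace ℝ (Fin 2)) 1) := ⟨ptA⟩

/-! ## §1 Rescaling a tube of radius `ε` to the unit tube -/

section Scale

variable {Y : Type*} [TopologicalSpace Y] [ChartedSpace (EuclideanSpace ℝ (Fin 3)) Y]

/-- The fibre scaling `(ψ, v) ↦ (ψ, ε v)` of `𝕊¹ × ℝ²` (`ε ≠ 0`), a homeomorphism. [folklore] -/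
def scaleFibre (ε : ℝ) (hε : ε ≠ 0) :
    (sphere (0 : EuclideanSpace ℝ (Fin 2)) 1 × EuclideanSpace ℝ (Fin 2)) ≃ₜ
      (sphere (0 : EuclideanSpace ℝ (Fin 2)) 1 × EuclideanSpace ℝ (Fin 2)) :=
  (Homeomorph.refl _).prodCongr (Homeomorph.smulOfNeZero ε hε)

/-- The fibre scaling, as a function. [folklore] -/
@[simp] theorem scaleFibre_apply (ε : ℝ) (hε : ε ≠ 0)
    (q : sphere (0 : EuclideanSpace ℝ (Fin 2)) 1 × EuclideanSpace ℝ (Fin 2)) :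
    scaleFibre ε hε q = (q.1, ε • q.2) := rfl

/-- The inverse fibre scaling, as a function. [folklore] -/
@[simp] theorem scaleFibre_symm_apply (ε : ℝ) (hε : ε ≠ 0)
    (q : sphere (0 : EuclideanSpace ℝ (Fin 2)) 1 × EuclideanSpace ℝ (Fin 2)) :
    (scaleFibre ε hε).symm q = (q.1, ε⁻¹ • q.2) := rfl

/-- The fibre scaling is smooth. [folklore] -/
theorem contMDiff_scaleFibre (ε : ℝ) (hε : ε ≠ 0) :
    ContMDiff ((𝓡 1).prod 𝓘(ℝ, EuclideanSpace ℝ (Fin 2))) ((𝓡 1).prod 𝓘(ℝ, EuclideanSpace ℝ (Fin 2))) ∞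
      (scaleFibre ε hε) :=
  contMDiff_fst.prodMk
    (((ε • ContinuousLinearMap.id ℝ (EuclideanSpace ℝ (Fin 2))).contMDiff).comp contMDiff_snd)

/-- **Rescaling a tube of radius `ε` to a `CircleTube`**: for an open partial homeomorphism
`Φ : 𝕊¹ × ℝ² ⇀ Y` with source `𝕊¹ × B(0, ε)`, `C^∞` with `C^∞` inverse, the map `(ψ, v) ↦ Φ (ψ, ε v)`
on the unit tube. [cite: Kosinski1993, III (3.1)] -/
def scaleTube (Φ : OpenPartialHomeomorph (sphere (0 : EuclideanSpace ℝ (Fin 2)) 1 ×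
      EuclideanSpace ℝ (Fin 2)) Y) {ε : ℝ} (hε : 0 < ε)
    (hsrc : Φ.source = (univ : Set (sphere (0 : EuclideanSpace ℝ (Fin 2)) 1)) ×ˢ
      ball (0 : EuclideanSpace ℝ (Fin 2)) ε)
    (hsm : ContMDiffOn ((𝓡 1).prod 𝓘(ℝ, EuclideanSpace ℝ (Fin 2))) (𝓡 3) ∞ Φ Φ.source)
    (hsymm : ContMDiffOn (𝓡 3) ((𝓡 1).prod 𝓘(ℝ, EuclideanSpace ℝ (Fin 2))) ∞ Φ.symm Φ.target) :
    CircleTube Y where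
  toHomeo := (scaleFibre ε hε.ne').transOpenPartialHomeomorph Φ
  source_eq := by
    rw [Homeomorph.transOpenPartialHomeomorph_source, hsrc]
    ext ⟨ψ, v⟩
    change (ψ, ε • v) ∈ (univ : Set (sphere (0 : EuclideanSpace ℝ (Fin 2)) 1)) ×ˢ
      ball (0 : EuclideanSpace ℝ (Fin 2)) ε ↔ _
    simp only [mem_prod, mem_univ, true_and, mem_ball_zero_iff, norm_smul, Real.norm_eq_abs,
      abs_of_pos hε]
    constructor <;> intro h <;> nlinarith
  contMDiffOn_toHomeo := by
    rw [Homeomorph.transOpenPartialHomeomorph_source, Homeomorph.transOpenPartialHomeomorph_apply]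
    exact hsm.comp (contMDiff_scaleFibre ε hε.ne').contMDiffOn fun q hq => hq
  contMDiffOn_symm := by
    rw [Homeomorph.transOpenPartialHomeomorph_target, Homeomorph.transOpenPartialHomeomorph_symm_apply]
    have h : ContMDiff ((𝓡 1).prod 𝓘(ℝ, EuclideanSpace ℝ (Fin 2)))
        ((𝓡 1).prod 𝓘(ℝ, EuclideanSpace ℝ (Fin 2))) ∞ (scaleFibre ε hε.ne').symm := by
      have h' := contMDiff_scaleFibre ε⁻¹ (inv_ne_zero hε.ne')
      refine h'.congr fun q => ?_
      rw [scaleFibre_symm_apply, scaleFibre_apply]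
    exact h.comp_contMDiffOn hsymm

/-- The rescaled tube, as a function. [folklore] -/
@[simp] theorem scaleTube_apply (Φ : OpenPartialHomeomorph (sphere (0 : EuclideanSpace ℝ (Fin 2)) 1 ×
      EuclideanSpace ℝ (Fin 2)) Y) {ε : ℝ} (hε : 0 < ε)
    (hsrc : Φ.source = (univ : Set (sphere (0 : EuclideanSpace ℝ (Fin 2)) 1)) ×ˢ
      ball (0 : EuclideanSpace ℝ (Fin 2)) ε)
    (hsm : ContMDiffOn ((𝓡 1).prod 𝓘(ℝ, EuclideanSpace ℝ (Fin 2))) (𝓡 3) ∞ Φ Φ.source)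
    (hsymm : ContMDiffOn (𝓡 3) ((𝓡 1).prod 𝓘(ℝ, EuclideanSpace ℝ (Fin 2))) ∞ Φ.symm Φ.target)
    (ψ : sphere (0 : EuclideanSpace ℝ (Fin 2)) 1) (v : EuclideanSpace ℝ (Fin 2)) :
    (scaleTube Φ hε hsrc hsm hsymm).toHomeo (ψ, v) = Φ (ψ, ε • v) := rfl

end Scale

/-! ## §1b Twisting the fibres of a tube by `±` the core angle -/

section Twist

variable {Y : Type*} [TopologicalSpace Y] [ChartedSpace (EuclideanSpace ℝ (Fin 3)) Y]

/-- **The fibre twist of a tube** (`σ² = 1`): `(ψ, w) ↦ Φ (ψ, fibreRot σ ψ w)`, the tube `Φ` with its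
fibre over `ψ` rotated by `±` the angle of `ψ` (`circleTwist`, `DehnSurgeryTwistProofs.lean`) — again a
`CircleTube`, with the same core and target, whose fibre frame along the core differs from that of `Φ`
by the rotation field `ψ ↦ ψ^{±1}` of degree `±1`: the device turning a tube transition of degree
`∓1` (a Lefschetz handle against the page frame) into one of degree `0`, as
`CircleTube.exists_diffeotopy_reflect` requires. [cite: Kosinski1993, III (3.1)] -/
def twistTube (Φ : CircleTube Y) (σ : ℝ) (hσ : σ ^ 2 = 1) : CircleTube Y where
  toHomeo := (circleTwist σ hσ).toHomeomorph.transOpenPartialHomeomorph Φ.toHomeo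
  source_eq := by
    rw [Homeomorph.transOpenPartialHomeomorph_source, Φ.source_eq]
    ext ⟨ψ, v⟩
    change (ψ, fibreRot σ (ψ : EuclideanSpace ℝ (Fin 2)) v) ∈
      (univ : Set (sphere (0 : EuclideanSpace ℝ (Fin 2)) 1)) ×ˢ ball (0 : EuclideanSpace ℝ (Fin 2)) 1 ↔ _
    simp only [mem_prod, mem_univ, true_and, mem_ball_zero_iff, BlowDownFlat.norm_fibreRot_sphere hσ]
  contMDiffOn_toHomeo := by
    rw [Homeomorph.transOpenPartialHomeomorph_source, Homeomorph.transOpenPartialHomeomorph_apply]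
    exact Φ.contMDiffOn_toHomeo.comp (circleTwist σ hσ).contMDiff.contMDiffOn fun q hq => hq
  contMDiffOn_symm := by
    rw [Homeomorph.transOpenPartialHomeomorph_target, Homeomorph.transOpenPartialHomeomorph_symm_apply]
    exact (circleTwist σ hσ).symm.contMDiff.comp_contMDiffOn Φ.contMDiffOn_symm

/-- The twisted tube, as a function. [folklore] -/
@[simp] theorem twistTube_apply (Φ : CircleTube Y) (σ : ℝ) (hσ : σ ^ 2 = 1)
    (ψ : sphere (0 : EuclideanSpace ℝ (Fin 2)) 1) (v : EuclideanSpace ℝ (Fin 2)) :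
    (twistTube Φ σ hσ).toHomeo (ψ, v) = Φ.toHomeo (ψ, fibreRot σ (ψ : EuclideanSpace ℝ (Fin 2)) v) := rfl

/-- The twisted tube has the same core. [folklore] -/
@[simp] theorem twistTube_core (Φ : CircleTube Y) (σ : ℝ) (hσ : σ ^ 2 = 1) :
    (twistTube Φ σ hσ).core = Φ.core := by
  funext ψ
  rw [CircleTube.core_apply, CircleTube.core_apply, twistTube_apply, fibreRot_zero]

/-- The twisted tube has the same target. [folklore] -/
theorem twistTube_target (Φ : CircleTube Y) (σ : ℝ) (hσ : σ ^ 2 = 1) :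
    (twistTube Φ σ hσ).toHomeo.target = Φ.toHomeo.target := rfl

/-- The twisted tube has the same source (the unit tube). [folklore] -/
theorem twistTube_source (Φ : CircleTube Y) (σ : ℝ) (hσ : σ ^ 2 = 1) :
    (twistTube Φ σ hσ).toHomeo.source = Φ.toHomeo.source := by
  rw [(twistTube Φ σ hσ).source_eq, Φ.source_eq]

end Twist

/-! ## §2 The registered sub-goal: the page-adapted circle tube -/

/-- A constant profile runs the rotation field at constant speed. [folklore] -/
theorem rotFieldA_const (κ : ℝ) (q : EuclideanSpace ℝ (Fin 4)) :
    rotFieldA g (fun _ => κ) q = κ • rotField g q := rfl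

/-- **The page-adapted circle tube around an embedded page curve** (registered sub-goal
`helper_exists_pageTube` of NF6, brick T3c-1 (3b)).  Let `K : 𝕊¹ → Base g` be a smooth embedding
with values in the page `page g c` (`‖c‖ = 1`) of the Lefschetz base.  Then there are a rate
`κ > 0`, the page-rotation isotopy `R` of `Base g` at rate `κ` — restriction of a smooth complete
flow `θ` of `κ · rotField g` (`rotFieldA g (fun _ => κ)`), preserving `rho` and the flat part
`‖x‖² < 4` and turning the page coordinate, `w (θ (t, x)) = e^{iκt} w (x)` near the base — and a tube
`Φ : CircleTube Y` around `K` in the boundary 3-manifold `Y = (bBase g).carrier = ∂ Base g`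
(Kosinski 1993, III (3.1)) such that: the core of `Φ` is `K`; `Φ` is FIBRED over the pages,
`Φ (ψ, v) = R_{v₁} (Φ (ψ, v₀ e₀))`, and `Φ (ψ, v)` lies in the page `page g (e^{iκ v₁} c)` — the first
fibre coordinate moves inside the page of `K` (a tubular neighbourhood of `K` in its page), the
second is the page angle; and at the zero section the fibre derivative of `Φ`, read in `ℝ⁴`, is
`v ↦ v₀ · r · i K' + v₁ · κ · rotField (K)` with `r > 0` (`K' = (ambCurve g K)'`, the in-page normal
`i K'` and the rotation field).  This is the second tube of node T3c-1, to be compared with the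
boundary tube of the attaching map by `CircleTube.exists_diffeotopy_reflect`.
[cite: Kosinski1993, III (3.1)] -/
theorem helper_exists_pageTube : ∀ (g : ℕ) (c : ℂ)
    (K : Metric.sphere (0 : EuclideanSpace ℝ (Fin 2)) 1 →
      Literature.Topology.FourManifolds.LefschetzBase.Base g),
    ‖c‖ = 1 → Manifold.IsSmoothEmbedding (𝓡 1) (𝓡∂ 4) ∞ K →
    (∀ θ, K θ ∈ Literature.Topology.FourManifolds.LefschetzBase.page g c) →
    ∃ (κ r : ℝ) (R : Literature.Topology.FourManifolds.AmbientIsotopy (𝓡∂ 4)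
        (Literature.Topology.FourManifolds.LefschetzBase.Base g))
      (θ : ℝ × EuclideanSpace ℝ (Fin 4) → EuclideanSpace ℝ (Fin 4))
      (Φ : Literature.Topology.FourManifolds.CircleTube
        (Literature.Topology.FourManifolds.LefschetzBase.bBase g).carrier),
      0 < κ ∧ 0 < r ∧ ContDiff ℝ ∞ θ ∧ (∀ x, θ (0, x) = x) ∧ (∀ t s x, θ (t, θ (s, x)) = θ (t + s, x)) ∧
      (∀ (t : ℝ) (x : Literature.Topology.FourManifolds.LefschetzBase.Base g),
        (R.toFun t x).1 = θ (t, x.1)) ∧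
      (∀ x t, HasDerivAt (fun t => θ (t, x))
        (Summit.SmoothPoincare4.SmoothPoincare4.Theorems.AcyclicBisectionExists.ModpBraidOrbits.rotFieldA
          g (fun _ => κ) (θ (t, x))) t) ∧
      (∀ t x, Literature.Topology.FourManifolds.LefschetzBase.rho g (θ (t, x)) =
        Literature.Topology.FourManifolds.LefschetzBase.rho g x) ∧
      (∀ t x, ‖Literature.Topology.FourManifolds.LefschetzBase.cx (θ (t, x))‖ ^ 2 < 4 ↔
        ‖Literature.Topology.FourManifolds.LefschetzBase.cx x‖ ^ 2 < 4) ∧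
      (∀ x, Literature.Topology.FourManifolds.LefschetzBase.rho g x ≤ 3 / 10 → ∀ t,
        Literature.Topology.FourManifolds.LefschetzBase.w g (θ (t, x)) =
          Complex.exp (Complex.I * κ * t) * Literature.Topology.FourManifolds.LefschetzBase.w g x) ∧
      (∀ ψ, (Literature.Topology.FourManifolds.LefschetzBase.bBase g).incl (Φ.core ψ) = K ψ) ∧
      (∀ (ψ : Metric.sphere (0 : EuclideanSpace ℝ (Fin 2)) 1) (v : EuclideanSpace ℝ (Fin 2)), ‖v‖ < 1 →
        (Literature.Topology.FourManifolds.LefschetzBase.bBase g).incl (Φ.toHomeo (ψ, v)) ∈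
          Literature.Topology.FourManifolds.LefschetzBase.page g
            (Complex.exp (Complex.I * κ * v 1) * c)) ∧
      (∀ (ψ : Metric.sphere (0 : EuclideanSpace ℝ (Fin 2)) 1) (v : EuclideanSpace ℝ (Fin 2)),
        (Literature.Topology.FourManifolds.LefschetzBase.bBase g).incl (Φ.toHomeo (ψ, v)) =
          R.toFun (v 1) ((Literature.Topology.FourManifolds.LefschetzBase.bBase g).incl
            (Φ.toHomeo (ψ, v 0 • Literature.Topology.FourManifolds.planeE0)))) ∧
      (∀ t : ℝ, HasFDerivAt (fun v : EuclideanSpace ℝ (Fin 2) =>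
          ((Literature.Topology.FourManifolds.LefschetzBase.bBase g).incl
            (Φ.toHomeo (Literature.Topology.FourManifolds.circlePt t, v))).1)
        ((EuclideanSpace.proj (𝕜 := ℝ) (0 : Fin 2)).smulRight
            (r • Literature.Topology.FourManifolds.LefschetzBase.cplxJ
              (deriv (Literature.Topology.FourManifolds.LefschetzBase.ambCurve g K) t)) +
          (EuclideanSpace.proj (𝕜 := ℝ) (1 : Fin 2)).smulRight
            (κ • Summit.SmoothPoincare4.SmoothPoincare4.Theorems.AcyclicBisectionExists.ModpBraidOrbits.rotField
              g (K (Literature.Topology.FourManifolds.circlePt t)).1)) 0) := by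
  intro g c K hc hK hKc
  -- the two flows
  obtain ⟨δ, hδ, hδK⟩ := exists_width hK.contMDiff hKc
  obtain ⟨C, hC, hCK⟩ := exists_norm_mPar_le (g := g) hK.contMDiff
  obtain ⟨Θ, hΘ, h0Θ, -, hderΘ, -, hrhoΘ, hwΘ⟩ := helper_pageField_flow g δ hδ
  obtain ⟨θ, hθ, h0θ, haddθ, hderθ⟩ := exists_rotFlow g (a := fun _ => (1 : ℝ)) contDiff_const
  have hrhoθ : ∀ t x, rho g (θ (t, x)) = rho g x := fun t x => by
    have h := rho_flowline_eq (hderθ x) t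
    rwa [h0θ] at h
  set m := mPar g K C with hm_def
  have hm : ContMDiff (𝓡 1) 𝓘(ℝ, ℂ) ∞ m := contMDiff_mPar hK.contMDiff C
  have hmem : ∀ q, rho g (tubeAmb θ Θ K m q) = 1 / 4 := rho_tubeAmb_eq hrhoΘ hrhoθ hc hKc
  have hsm := contMDiff_tubeAmb hθ hΘ hK.contMDiff hm
  -- the tube map is a local diffeomorphism along the zero section, injective there
  have hloc0 : ∀ ψ, IsLocalDiffeomorphAt ((𝓡 1).prod 𝓘(ℝ, EuclideanSpace ℝ (Fin 2))) (𝓡 3) ∞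
      (tubeMap hmem) (ψ, 0) := fun ψ =>
    isLocalDiffeomorphAt_tubeMap hmem hsm
      (injective_mfderiv_tubeAmb_zero hθ h0θ hderθ hΘ h0Θ hderΘ hc hK hKc hδ hδK hC hCK ψ)
  have hinj0 : Injective fun ψ => tubeMap hmem (ψ, 0) := by
    intro ψ ψ' h
    have h' : tubeAmb θ Θ K m (ψ, 0) = tubeAmb θ Θ K m (ψ', 0) :=
      congrArg (fun y : (bBase g).carrier => ((bBase g).incl y).1) h
    rw [tubeAmb_zero h0Θ h0θ, tubeAmb_zero h0Θ h0θ] at h'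
    exact hK.isEmbedding.injective (Subtype.ext h')
  -- the flat part is an open neighbourhood of the zero section
  set W : Set (sphere (0 : EuclideanSpace ℝ (Fin 2)) 1 × EuclideanSpace ℝ (Fin 2)) :=
    {q | ‖cx (tubeAmb θ Θ K m q)‖ ^ 2 < 4} with hW_def
  have hW : IsOpen W :=
    isOpen_lt ((contDiff_cx.continuous.comp hsm.continuous).norm.pow 2) continuous_const
  have hW0 : ∀ ψ, ((ψ, (0 : EuclideanSpace ℝ (Fin 2))) :
      sphere (0 : EuclideanSpace ℝ (Fin 2)) 1 × EuclideanSpace ℝ (Fin 2)) ∈ W := fun ψ => by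
    show ‖cx (tubeAmb θ Θ K m (ψ, 0))‖ ^ 2 < 4
    rw [tubeAmb_zero h0Θ h0θ]
    exact (hKc ψ).1
  obtain ⟨Φε, ε, hε, hsrc, hsrcW, hcoe, hsmε, hsymmε⟩ :=
    helper_tube_of_localDiffeo_zero hloc0 hinj0 hW hW0
  -- the rescaled rotation flow
  set θ' : ℝ × EuclideanSpace ℝ (Fin 4) → EuclideanSpace ℝ (Fin 4) := fun p => θ (ε * p.1, p.2)
    with hθ'_def
  have hθ' : ContDiff ℝ ∞ θ' := hθ.comp ((contDiff_const.mul contDiff_fst).prodMk contDiff_snd)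
  have h0θ' : ∀ x, θ' (0, x) = x := fun x => by simp only [hθ'_def, mul_zero, h0θ]
  have haddθ' : ∀ t s x, θ' (t, θ' (s, x)) = θ' (t + s, x) := fun t s x => by
    simp only [hθ'_def, haddθ, mul_add]
  have hrhoθ' : ∀ t x, rho g (θ' (t, x)) = rho g x := fun t x => hrhoθ _ _
  have hderθ' : ∀ x t, HasDerivAt (fun t => θ' (t, x)) (rotFieldA g (fun _ => ε) (θ' (t, x))) t := by
    intro x t
    have h := (hderθ x (ε * t)).scomp t (((hasDerivAt_id t).const_mul ε))
    rw [mul_one, rotFieldA_const, smul_smul, mul_one] at h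
    exact h
  set R := baseIsotopy hrhoθ' h0θ' haddθ' hθ' with hR_def
  set Φ : CircleTube (bBase g).carrier := scaleTube Φε hε hsrc hsmε hsymmε with hΦ_def
  have hΦ : ∀ ψ v, ((bBase g).incl (Φ.toHomeo (ψ, v))).1 = tubeAmb θ Θ K m (ψ, ε • v) := fun ψ v => by
    rw [hΦ_def, scaleTube_apply, hcoe]; rfl
  refine ⟨ε, ε * C⁻¹, R, θ', Φ, hε, mul_pos hε (inv_pos.2 hC), hθ', h0θ', haddθ', fun t x => rfl,
    hderθ', hrhoθ', fun t x => ?_, fun x hx t => ?_, fun ψ => ?_, fun ψ v hv => ?_, fun ψ v => ?_,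
    fun t => ?_⟩
  · -- the flat part is invariant
    have h := norm_sq_cx_flowline_lt_four_iff (hderθ' x) t
    rwa [h0θ'] at h
  · -- the page coordinate turns at rate `κ = ε`
    have h := w_flowline_eq_exp_mul (hderθ' x) (by rwa [h0θ']) (κ := ε) (fun _ => rfl) t
    rwa [h0θ'] at h
  · -- core
    apply Subtype.ext
    rw [CircleTube.core_apply, hΦ, smul_zero, tubeAmb_zero h0Θ h0θ]
  · -- fibred over the pages: `Φ (ψ, v) ∈ page (e^{iκ v₁} c)`
    have hsrc' : ((ψ, ε • v) : sphere (0 : EuclideanSpace ℝ (Fin 2)) 1 × EuclideanSpace ℝ (Fin 2)) ∈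
        Φε.source := by
      rw [hsrc]
      refine ⟨mem_univ _, mem_ball_zero_iff.2 ?_⟩
      rw [norm_smul, Real.norm_eq_abs, abs_of_pos hε]
      nlinarith
    refine ⟨by rw [hΦ]; exact hsrcW hsrc', ?_⟩
    rw [hΦ]
    show w g (θ ((ε • v) 1, inPageAmb Θ K m (ψ, (ε • v) 0))) = _
    have hP : rho g (inPageAmb Θ K m (ψ, (ε • v) 0)) ≤ 3 / 10 := by
      rw [rho_inPageAmb hrhoΘ, rho_eq_of_mem_page g hc (hKc _)]; norm_num
    have hw := w_flowline_eq_exp_mul (hderθ (inPageAmb Θ K m (ψ, (ε • v) 0))) (by rwa [h0θ])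
      (κ := 1) (fun _ => rfl) ((ε • v) 1)
    rw [h0θ, w_inPageAmb hwΘ, (hKc ψ).2] at hw
    rw [hw, PiLp.smul_apply, smul_eq_mul, mul_div_assoc]
    congr 2
    push_cast
    ring
  · -- `Φ (ψ, v) = R_{v₁} (Φ (ψ, v₀ e₀))`
    apply Subtype.ext
    rw [coe_baseIsotopy_toFun, hΦ, hΦ]
    simp only [tubeAmb, hθ'_def, PiLp.smul_apply, smul_eq_mul, planeE0_apply_zero, planeE0_apply_one,
      mul_one, mul_zero, h0θ]
  · -- the fibre derivative at the zero section
    set z : EuclideanSpace ℝ (Fin 4) × ℂ := ((K (circlePt t)).1, m (circlePt t)) with hz_def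
    have hfun : (fun v : EuclideanSpace ℝ (Fin 2) => ((bBase g).incl (Φ.toHomeo (circlePt t, v))).1) =
        (tubeCore θ Θ ∘ fun y : EuclideanSpace ℝ (Fin 2) => (y, z)) ∘
          (ε • ContinuousLinearMap.id ℝ (EuclideanSpace ℝ (Fin 2))) := by
      funext v; rw [hΦ]; rfl
    have h3 : HasFDerivAt (tubeCore θ Θ ∘ fun y : EuclideanSpace ℝ (Fin 2) => (y, z))
        ((fderiv ℝ (tubeCore θ Θ) ((0 : EuclideanSpace ℝ (Fin 2)), z)).comp
          (ContinuousLinearMap.inl ℝ (EuclideanSpace ℝ (Fin 2)) (EuclideanSpace ℝ (Fin 4) × ℂ)))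
        ((ε • ContinuousLinearMap.id ℝ (EuclideanSpace ℝ (Fin 2))) 0) := by
      have h := (((contDiff_tubeCore hθ hΘ).differentiable (by simp)) ((0 : EuclideanSpace ℝ (Fin 2)), z)
        ).hasFDerivAt.comp 0 (hasFDerivAt_prodMk_left (𝕜 := ℝ) (0 : EuclideanSpace ℝ (Fin 2)) z)
      simpa using h
    rw [hfun]
    refine (h3.comp 0 (ε • ContinuousLinearMap.id ℝ (EuclideanSpace ℝ (Fin 2))).hasFDerivAt).congr_fderiv
      ?_
    ext1 v
    have hρ : rho g (K (circlePt t)).1 = 1 / 4 := rho_eq_of_mem_page g hc (hKc _)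
    have hcut : tubeCut g δ z = 1 := by
      rw [tubeCut, cutA_of_le (by rw [hρ]; norm_num), flatCut_of_le hδ (hδK _), parCut_of_le (hCK _),
        one_mul, one_mul]
    have hpf : (pageFieldP g δ z).1 = C⁻¹ • cplxJ (deriv (ambCurve g K) t) := by
      rw [pageFieldP_fst, hcut, one_smul]
      exact kerVec_mPar hK.contMDiff hKc C t
    change fderiv ℝ (tubeCore θ Θ) ((0 : EuclideanSpace ℝ (Fin 2)), z) (ε • v, 0) =
      v 0 • ((ε * C⁻¹) • cplxJ (deriv (ambCurve g K) t)) + v 1 • (ε • rotField g (K (circlePt t)).1)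
    rw [fderiv_tubeCore_apply hθ h0θ hderθ hΘ h0Θ hderΘ, hpf, rotFieldA_const, Prod.fst_zero, zero_add]
    simp only [PiLp.smul_apply, smul_eq_mul, smul_smul]
    congr 1 <;> congr 1 <;> ring

end Summit.SmoothPoincare4.SmoothPoincare4.Theorems.AcyclicBisectionExists.ModpBraidOrbits
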